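import Summits.HodgeConjecture.CorCM.GaloisCyclicSemidirectEightNormPairSheets
import Summits.HodgeConjecture.CorCM.CyclotomicGaussianIndependence
import HarnessLib

/-!
# Sheets of `C_p ⋊ C₈` at an odd character: «singular block ⟹ `μ₄`-norm pair», «vanishing sheet sum ⟹ constant sheet»

COR-CM (cell `pub-hodgecm2`), binder seat b04 (gen 29), count-neutral claim CYCLIC-SEMIDIRECT-EIGHT-DEGENERATE, part VIIIa₂
(the two lemmas of the converse that use part VII `CorCM/CyclotomicGaussianIndependence` — the `ℚ(i)`-independence of the
`p`-th roots of unity; the field-free lemmas are part VIIIa₁ `…NormPairSheets`).  KERNEL ONLY: theorems; no definition, no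
named fact, no `sorry`.  `HC_CM` is neither used nor claimed.

* **`normPair_of_det_eq_zero`**: for `α = ±i` and `β` a PRIMITIVE `p`-th root of unity, `G₀(β)G₀(β⁻¹) = α G₁(β)G₁(β⁻¹)`
  (`Gⱼ(β) = Σ_v α^{kⱼ(v)} β^v`) forces the two balance identities of part V `CorCM/GaloisCyclicSemidirectEightNormPairs`
  verbatim: the coefficient `R(d) + I(d)α` of `β^d` is constant in `d` by `CyclotomicGaussian.eq_of_sum_gaussian_mul_pow_eq_zero`;
* **`const_of_sheet_sum_eq_zero`**: `G(β) = 0` at a primitive `β` forces the sheet `k` to be constant (its coordinates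
  `a(k v), b(k v)` are constant in `v`, and they determine `k v`).

## References

* [Kubota1965] T. Kubota, *On the field extension by complex multiplication*, Trans. AMS 118 (1965), §4 Lemma 2.
* [Washington1997] L. C. Washington, *Introduction to Cyclotomic Fields*, 2nd ed., GTM 83, Thm. 2.5.
-/

noncomputable section

open scoped BigOperators

namespace Summit.HodgeConjecture.CorCM.GaloisCyclicSemidirectEight

open Literature.NumberTheory.ComplexMultiplication (IsCMTypeWith)
open Summit.HodgeConjecture.CorCM.GaloisQuaternionCyclic (omega_mul_omega)
open Summit.HodgeConjecture.CorCM.CyclotomicGaussian (eq_of_sum_gaussian_mul_pow_eq_zero)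
open AddChar
open Multiplicative (ofAdd toAdd)

section Sheets

variable {p : ℕ} [Fact p.Prime]

/-- **A singular block at a character non-trivial on `ℤ/p` is a `μ₄`-norm pair.**  If
`G₀(β)G₀(β⁻¹) = α·G₁(β)G₁(β⁻¹)` with `Gⱼ(β) = Σ_v ψ_α(kⱼ v) β^v`, `α = ±i` and `β` a PRIMITIVE `p`-th root of unity, then
the two balance identities of `CorCM/GaloisCyclicSemidirectEightNormPairs` hold: the coefficient `R(d) + I(d)·α` of `β^d` is
constant in `d` by the `ℚ(i)`-independence of the `p`-th roots of unity. [cite: Kubota1965, §4 Lemma 2]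
[cite: Washington1997, Thm. 2.5] -/
theorem normPair_of_det_eq_zero (hp2 : p ≠ 2) {α : ℂ} {ε : ℤ} (hε : ε = 1 ∨ ε = -1) (hα : α = ε * Complex.I)
    {β : ℂ} (hβ : IsPrimitiveRoot β p) (k₀ k₁ : ZMod p → ZMod (2 * 2))
    (h : (∑ v : ZMod p, zmodChar (2 * 2) (alpha_pow_four hε hα) (k₀ v) * zmodChar p hβ.pow_eq_one v) *
          (∑ v : ZMod p, zmodChar (2 * 2) (alpha_pow_four hε hα) (k₀ v) * zmodChar p hβ.pow_eq_one (-v)) -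
        α * ((∑ v : ZMod p, zmodChar (2 * 2) (alpha_pow_four hε hα) (k₁ v) * zmodChar p hβ.pow_eq_one v) *
          (∑ v : ZMod p, zmodChar (2 * 2) (alpha_pow_four hε hα) (k₁ v) * zmodChar p hβ.pow_eq_one (-v))) = 0) :
    (∀ d : ZMod p,
      (Finset.univ.filter fun v => k₀ v + k₀ (v - d) = 0).card +
            (Finset.univ.filter fun v => k₁ v + k₁ (v - d) = 1).card +
          (Finset.univ.filter fun v => k₀ v + k₀ v = 2).card + (Finset.univ.filter fun v => k₁ v + k₁ v = 3).card =
        (Finset.univ.filter fun v => k₀ v + k₀ v = 0).card + (Finset.univ.filter fun v => k₁ v + k₁ v = 1).card +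
            (Finset.univ.filter fun v => k₀ v + k₀ (v - d) = 2).card +
          (Finset.univ.filter fun v => k₁ v + k₁ (v - d) = 3).card) ∧
    (∀ d : ZMod p,
      (Finset.univ.filter fun v => k₀ v + k₀ (v - d) = 1).card +
            (Finset.univ.filter fun v => k₁ v + k₁ (v - d) = 2).card +
          (Finset.univ.filter fun v => k₀ v + k₀ v = 3).card + (Finset.univ.filter fun v => k₁ v + k₁ v = 0).card =
        (Finset.univ.filter fun v => k₀ v + k₀ v = 1).card + (Finset.univ.filter fun v => k₁ v + k₁ v = 2).card +
            (Finset.univ.filter fun v => k₀ v + k₀ (v - d) = 3).card +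
          (Finset.univ.filter fun v => k₁ v + k₁ (v - d) = 0).card) := by
  classical
  have hp : p.Prime := Fact.out
  haveI : NeZero p := ⟨hp.ne_zero⟩
  have hαα : α * α = -1 := alpha_mul_self hε hα
  set ψ4 := zmodChar (2 * 2) (alpha_pow_four hε hα) with hψ4_def
  set ψp := zmodChar p hβ.pow_eq_one with hψp_def
  -- integer coordinates of the coefficients
  set a : ZMod (2 * 2) → ℤ := fun s => (if s = 0 then 1 else 0) - (if s = 2 then 1 else 0) with ha_def
  set b : ZMod (2 * 2) → ℤ := fun s => (if s = 1 then 1 else 0) - (if s = 3 then 1 else 0) with hb_def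
  set R : ZMod p → ℤ := fun d => ∑ v, a (k₀ v + k₀ (v - d)) + ∑ v, b (k₁ v + k₁ (v - d)) with hR_def
  set I : ZMod p → ℤ := fun d => ∑ v, b (k₀ v + k₀ (v - d)) - ∑ v, a (k₁ v + k₁ (v - d)) with hI_def
  have hcoef : ∀ d : ZMod p, (∑ v : ZMod p, ψ4 (k₀ v + k₀ (v - d))) - α * (∑ v : ZMod p, ψ4 (k₁ v + k₁ (v - d))) =
      (R d : ℂ) + (I d : ℂ) * α := fun d => by
    rw [hψ4_def, sum_psi_eq_coord _ hαα, sum_psi_eq_coord _ hαα]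
    simp only [hR_def, hI_def, ha_def, hb_def, Int.cast_add, Int.cast_sub]
    linear_combination (-((∑ v : ZMod p, ((if k₁ v + k₁ (v - d) = 1 then 1 else 0) -
      (if k₁ v + k₁ (v - d) = 3 then 1 else 0) : ℤ) : ℤ) : ℂ)) * hαα
  -- the identity `Σ_d (R(d) + I(d) α) β^d = 0`
  have hsum : ∑ d : ZMod p, ((R d : ℂ) + ((ε * I d : ℤ) : ℂ) * Complex.I) * β ^ d.val = 0 := by
    rw [sheet_mul_sheet, sheet_mul_sheet, Finset.mul_sum, ← Finset.sum_sub_distrib] at h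
    rw [← h]
    refine Finset.sum_congr rfl fun d _ => ?_
    rw [hψp_def, zmodChar_apply, ← mul_assoc, ← sub_mul, hcoef d, hα]
    push_cast
    ring
  obtain ⟨hR, hI⟩ := eq_of_sum_gaussian_mul_pow_eq_zero hp2 hβ R (fun d => ε * I d) hsum
  have hε0 : ε ≠ 0 := by rcases hε with rfl | rfl <;> norm_num
  have hI' : ∀ d, I d = I 0 := fun d => mul_left_cancel₀ hε0 (hI d)
  -- unpack into the card identities
  have hcardA : ∀ (k : ZMod p → ZMod (2 * 2)) (d : ZMod p), ∑ v, a (k v + k (v - d)) =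
      ((Finset.univ.filter fun v => k v + k (v - d) = 0).card : ℤ) -
        ((Finset.univ.filter fun v => k v + k (v - d) = 2).card : ℤ) := fun k d => by
    simp only [ha_def, Finset.sum_sub_distrib, Finset.sum_boole]
  have hcardB : ∀ (k : ZMod p → ZMod (2 * 2)) (d : ZMod p), ∑ v, b (k v + k (v - d)) =
      ((Finset.univ.filter fun v => k v + k (v - d) = 1).card : ℤ) -
        ((Finset.univ.filter fun v => k v + k (v - d) = 3).card : ℤ) := fun k d => by
    simp only [hb_def, Finset.sum_sub_distrib, Finset.sum_boole]
  have h0 : ∀ (k : ZMod p → ZMod (2 * 2)) (r : ZMod (2 * 2)),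
      (Finset.univ.filter fun v => k v + k (v - 0) = r) = (Finset.univ.filter fun v => k v + k v = r) := fun k r => by
    simp only [sub_zero]
  refine ⟨fun d => ?_, fun d => ?_⟩
  · have h1 := hR d
    simp only [hR_def, hcardA, hcardB, h0] at h1
    omega
  · have h1 := hI' d
    simp only [hI_def, hcardA, hcardB, h0] at h1
    omega

/-- **A vanishing sheet sum at a primitive `β` forces a constant sheet**: `Σ_v ψ_α(k v) β^v = 0` ⟹ `k` constant (again
by `ℚ(i)`-independence: the coordinates `a(k v), b(k v)` are constant in `v`). [cite: Washington1997, Thm. 2.5] -/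
theorem const_of_sheet_sum_eq_zero (hp2 : p ≠ 2) {α : ℂ} {ε : ℤ} (hε : ε = 1 ∨ ε = -1) (hα : α = ε * Complex.I)
    {β : ℂ} (hβ : IsPrimitiveRoot β p) (k : ZMod p → ZMod (2 * 2))
    (h : ∑ v : ZMod p, zmodChar (2 * 2) (alpha_pow_four hε hα) (k v) * zmodChar p hβ.pow_eq_one v = 0) :
    ∀ v, k v = k 0 := by
  have hp : p.Prime := Fact.out
  haveI : NeZero p := ⟨hp.ne_zero⟩
  have hαα : α * α = -1 := alpha_mul_self hε hα
  set a : ZMod (2 * 2) → ℤ := fun s => (if s = 0 then 1 else 0) - (if s = 2 then 1 else 0) with ha_def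
  set b : ZMod (2 * 2) → ℤ := fun s => (if s = 1 then 1 else 0) - (if s = 3 then 1 else 0) with hb_def
  have hsum : ∑ v : ZMod p, ((a (k v) : ℂ) + ((ε * b (k v) : ℤ) : ℂ) * Complex.I) * β ^ v.val = 0 := by
    rw [← h]
    refine Finset.sum_congr rfl fun v _ => ?_
    rw [psi_eq_coord _ hαα, zmodChar_apply, hα]
    simp only [ha_def, hb_def]
    push_cast
    ring
  obtain ⟨ha, hb⟩ := eq_of_sum_gaussian_mul_pow_eq_zero hp2 hβ (fun v => a (k v)) (fun v => ε * b (k v)) hsum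
  have hε0 : ε ≠ 0 := by rcases hε with rfl | rfl <;> norm_num
  intro v
  exact eq_of_coord_eq (k v) (k 0) (ha v) (mul_left_cancel₀ hε0 (hb v))

end Sheets

end Summit.HodgeConjecture.CorCM.GaloisCyclicSemidirectEight

end
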